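import Summits.NavierStokesRegularity.NavierStokesRegularity.Theses.TypeICertificateLadder
import Summits.NavierStokesRegularity.NavierStokesRegularity.Theorems.TypeICertificateLadderTargetTypeIZoom
import Summits.NavierStokesRegularity.NavierStokesRegularity.Theorems.TypeICertificateLadderTargetAncientPressure
import Summits.NavierStokesRegularity.NavierStokesRegularity.Theorems.TypeICertificateLadderTargetGaussianDissipation
import Summits.NavierStokesRegularity.NavierStokesRegularity.Theorems.TypeICertificateLadderTargetGaussianChannel
import Summits.NavierStokesRegularity.NavierStokesRegularity.Theorems.TypeICertificateLadderTargetGaussianEnergyDeriv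
import Summits.NavierStokesRegularity.NavierStokesRegularity.Theorems.TypeICertificateLadderTargetHeadFluxCriterion
import Summits.NavierStokesRegularity.NavierStokesRegularity.Theorems.TypeICertificateLadderLadderGlue
import HarnessLib

/-!
# Line `head-flux-channel` (crux stmt-NavierStokesRegularity-1217, `TypeICertificateLadder.NoTypeIBlowup`):
# the unconditional consequences of the six landed stubs

Lead prover `prover-line-stmt-NavierStokesRegularity-1217-0`, 2026-08-16. All analytic stubs of the line
are tree theorems now: the zoom `stub_typeIZoom` (S1a), the global pressure `stub_ancientPressure`
(S1b), the Gaussian regularity/identity clauses `stub_gaussianDissipationContinuous` (S2a),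
`stub_gaussianChannelContinuous` (S2b), `stub_gaussianEnergyDeriv` (S2c), and the head-flux criterion
`stub_headFluxCriterion` (S3). This file records what they give WITHOUT the load-bearing stub S4
(`stub_headInfluxLaw`, the head-influx law, open):

* `toroidalTypeILiouville` — the card's free instance FL1, now UNCONDITIONAL: a Type-I ancient mild
  field in the Oseen gauge (`IsTypeIAncientMild C u`) whose flow is tangent to every sphere about the
  origin, `⟪x, u(t,x)⟫ = 0`, vanishes identically (the channel integrand is zero, so the law holds
  with `ε = ½`, and S3 applies with the pressure of S1b and the calculus of S2). Symmetry-free (the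
  toroidal half of the Mie decomposition about the singular point);
* `rateClassLiouville_of_headInfluxLaw`, `headInfluxLaw_iff_rateClassLiouville` — S4 at level `C` is
  EQUIVALENT to Type-I Liouville in the rate class at level `C`, unconditionally (the content of the
  refuter's costume lemma `TargetNegative.HeadInfluxLawCostume.stub_headInfluxLaw_iff_liouville`,
  whose four calculus hypotheses are discharged by the landed stubs; re-derived here directly from
  the landed stubs, with the explicit-constant easy direction `headInfluxLaw_half_of_rateClassLiouville`);
* `noTypeIBlowup_of_headInfluxLaw` — the skeleton's composition `Target_of` with S4 as its only
  hypothesis: `(∀ C > 0, S4(C)) → NoTypeIBlowup`, i.e. the line is CLOSED MODULO S4.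

No definitions; every statement is spelled over tree vocabulary.
-/

noncomputable section

namespace Summit.NavierStokesRegularity.NavierStokesRegularity.Theorems

open MeasureTheory Set Filter Topology
open scoped RealInnerProductSpace
open Literature.Analysis.FluidPDE

/-- **Toroidal Type-I Liouville theorem** (FL1 of the idea card `head-flux-channel`, unconditional):
a Type-I ancient mild field in the Oseen gauge whose slices are tangent to every sphere about the
origin — `⟪x, u(t,x)⟫ = 0` for all `t < 0`, `x` — is identically zero on `t < 0`. Proof: with the
classical pressure `q` of `stub_ancientPressure`, the head-flux channel
`Ch(s) = ∫ (½‖U‖² + P)⟪y,U⟫G` vanishes identically (`⟪y, U(s,y)⟫ = e^{s/2}·0`), so the head-influx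
law holds with `ε = ½`, `S₀ = 0` (its right-hand side is a nonnegative budget), and the landed
criterion `stub_headFluxCriterion` (fed by `stub_gaussianDissipationContinuous`,
`stub_gaussianChannelContinuous`, `stub_gaussianEnergyDeriv`) forces `u ≡ 0`. [folklore composition
of the line's landed stubs; the statement is the card's FL1] -/
theorem toroidalTypeILiouville :
    ∀ (C : ℝ) (u : ℝ → EuclideanSpace ℝ (Fin 3) → EuclideanSpace ℝ (Fin 3)), Literature.Analysis.FluidPDE.IsTypeIAncientMild C u → (∀ t < 0, ∀ x, inner ℝ x (u t x) = 0) → ∀ t < 0, ∀ x, u t x = 0 := by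
  intro C u hA htor
  obtain ⟨q, hcl⟩ := stub_ancientPressure C u hA
  refine stub_headFluxCriterion C u q hA (stub_gaussianDissipationContinuous C u hA)
    (stub_gaussianChannelContinuous C u q hA hcl) (stub_gaussianEnergyDeriv C u q hA hcl)
    ⟨1 / 2, by norm_num, 0, fun a b hab => ?_⟩
  -- the channel vanishes at every similarity time
  have hzero : ∀ s : ℝ,
      (∫ y, (‖lerayOrbit u s y‖ ^ 2 / 2 + lerayOrbitPressure q s y) *
          ⟪y, lerayOrbit u s y⟫ * Real.exp (-‖y‖ ^ 2 / 4)) = 0 := by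
    intro s
    refine integral_eq_zero_of_ae (Eventually.of_forall fun y => ?_)
    have ht : -Real.exp (-s) < 0 := neg_neg_of_pos (Real.exp_pos _)
    have key := htor _ ht (Real.exp (-s / 2) • y)
    have hinner : ⟪y, lerayOrbit u s y⟫ = 0 := by
      rw [lerayOrbit_apply, real_inner_smul_right]
      rw [real_inner_smul_left] at key
      rcases mul_eq_zero.1 key with h | h
      · exact absurd h (Real.exp_pos _).ne'
      · rw [h, mul_zero]
    simp only [hinner, mul_zero, zero_mul, Pi.zero_apply]
  simp only [hzero, neg_zero, zero_div, intervalIntegral.integral_zero]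
  have hab' : a ≤ b := by linarith
  refine mul_nonneg (by norm_num) (intervalIntegral.integral_nonneg hab' fun s _ => ?_)
  exact add_nonneg
    (integral_nonneg fun y => mul_nonneg (frobeniusNormSq_nonneg _) (Real.exp_pos _).le)
    (integral_nonneg fun y => mul_nonneg (by positivity) (Real.exp_pos _).le)

/-- **S4 at level `C` implies Type-I Liouville in the rate class at level `C`** — unconditionally,
by the landed S1b, S2a–S2c and S3 (the refuter's `liouville_of_stub_headInfluxLaw` with its calculus
hypotheses discharged). [folklore composition] -/
theorem rateClassLiouville_of_headInfluxLaw (C : ℝ)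
    (hS4 : ∀ (u : ℝ → EuclideanSpace ℝ (Fin 3) → EuclideanSpace ℝ (Fin 3))
      (p : ℝ → EuclideanSpace ℝ (Fin 3) → ℝ),
      IsTypeIAncientMild C u → IsClassicalNSSolutionOn (Set.Iio 0) 1 0 u p →
      ∃ ε : ℝ, 0 < ε ∧ ∃ S₀ : ℝ, ∀ a b : ℝ, a + S₀ ≤ b →
        (∫ s in a..b, -(∫ y, (‖lerayOrbit u s y‖ ^ 2 / 2 + lerayOrbitPressure p s y) *
            ⟪y, lerayOrbit u s y⟫ * Real.exp (-‖y‖ ^ 2 / 4)) / 2) ≤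
          (1 - ε) * ∫ s in a..b,
            ((∫ y, frobeniusNormSq (fderiv ℝ (lerayOrbit u s) y) * Real.exp (-‖y‖ ^ 2 / 4)) +
              ∫ y, ‖lerayOrbit u s y‖ ^ 2 / 2 * Real.exp (-‖y‖ ^ 2 / 4))) :
    ∀ u : ℝ → EuclideanSpace ℝ (Fin 3) → EuclideanSpace ℝ (Fin 3),
      IsTypeIAncientMild C u → ∀ t < 0, ∀ x, u t x = 0 := by
  intro u hA
  obtain ⟨q, hq⟩ := stub_ancientPressure C u hA
  exact stub_headFluxCriterion C u q hA (stub_gaussianDissipationContinuous C u hA)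
    (stub_gaussianChannelContinuous C u q hA hq) (stub_gaussianEnergyDeriv C u q hA hq) (hS4 u q hA hq)

/-- **Type-I Liouville in the rate class at level `C` makes the head-influx law trivial** — with
the explicit constants `ε = ½` and on EVERY window (no length restriction): the class is `{0}`, the
Leray orbit and its gradient vanish, both window integrals are `0`. (Explicit-constant form of the
easy direction of the costume equivalence; the pressure plays no role.) [folklore] -/
theorem headInfluxLaw_half_of_rateClassLiouville (C : ℝ)
    (hL : ∀ u : ℝ → EuclideanSpace ℝ (Fin 3) → EuclideanSpace ℝ (Fin 3),
      IsTypeIAncientMild C u → ∀ t < 0, ∀ x, u t x = 0)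
    (u : ℝ → EuclideanSpace ℝ (Fin 3) → EuclideanSpace ℝ (Fin 3))
    (p : ℝ → EuclideanSpace ℝ (Fin 3) → ℝ) (hA : IsTypeIAncientMild C u) (a b : ℝ) :
    (∫ s in a..b, -(∫ y, (‖lerayOrbit u s y‖ ^ 2 / 2 + lerayOrbitPressure p s y) *
        ⟪y, lerayOrbit u s y⟫ * Real.exp (-‖y‖ ^ 2 / 4)) / 2) ≤
      (1 - 1 / 2) * ∫ s in a..b,
        ((∫ y, frobeniusNormSq (fderiv ℝ (lerayOrbit u s) y) * Real.exp (-‖y‖ ^ 2 / 4)) +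
          ∫ y, ‖lerayOrbit u s y‖ ^ 2 / 2 * Real.exp (-‖y‖ ^ 2 / 4)) := by
  have hz : ∀ t < 0, ∀ x, u t x = 0 := hL u hA
  have hU : ∀ s : ℝ, lerayOrbit u s = fun _ => 0 := fun s => by
    funext y
    rw [lerayOrbit_apply, hz _ (neg_neg_of_pos (Real.exp_pos _)), smul_zero]
  have hUy : ∀ (s : ℝ) (y : EuclideanSpace ℝ (Fin 3)), lerayOrbit u s y = 0 := fun s y => by
    rw [hU s]
  have hfd : ∀ (s : ℝ) (y : EuclideanSpace ℝ (Fin 3)), fderiv ℝ (lerayOrbit u s) y = 0 :=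
    fun s y => by rw [hU s]; simp
  simp only [hUy, hfd, frobeniusNormSq_zero, norm_zero, inner_zero_right, mul_zero, zero_mul,
    integral_zero, neg_zero, zero_div, intervalIntegral.integral_zero]
  norm_num

/-- **The head-influx law IS Type-I Liouville in the rate class, level by level — unconditionally.**
`S4(C) ↔ (∀ u, IsTypeIAncientMild C u → u ≡ 0 on t < 0)`: the refuter's costume equivalence
`stub_headInfluxLaw_iff_liouville` with its four hypotheses S1b, S2a, S2b, S2c supplied by the landed
stubs. This is the precise sense in which the line's last stub is crux-sized: by
`noTypeIBlowup_of_rateClassLiouville` (`TypeICertificateLadderTargetRateClassLiouville.lean`), its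
right-hand side for all `C` already gives the crux.
[folklore composition] -/
theorem headInfluxLaw_iff_rateClassLiouville (C : ℝ) :
    (∀ (u : ℝ → EuclideanSpace ℝ (Fin 3) → EuclideanSpace ℝ (Fin 3))
      (p : ℝ → EuclideanSpace ℝ (Fin 3) → ℝ),
      IsTypeIAncientMild C u → IsClassicalNSSolutionOn (Set.Iio 0) 1 0 u p →
      ∃ ε : ℝ, 0 < ε ∧ ∃ S₀ : ℝ, ∀ a b : ℝ, a + S₀ ≤ b →
        (∫ s in a..b, -(∫ y, (‖lerayOrbit u s y‖ ^ 2 / 2 + lerayOrbitPressure p s y) *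
            ⟪y, lerayOrbit u s y⟫ * Real.exp (-‖y‖ ^ 2 / 4)) / 2) ≤
          (1 - ε) * ∫ s in a..b,
            ((∫ y, frobeniusNormSq (fderiv ℝ (lerayOrbit u s) y) * Real.exp (-‖y‖ ^ 2 / 4)) +
              ∫ y, ‖lerayOrbit u s y‖ ^ 2 / 2 * Real.exp (-‖y‖ ^ 2 / 4))) ↔
    (∀ u : ℝ → EuclideanSpace ℝ (Fin 3) → EuclideanSpace ℝ (Fin 3),
      IsTypeIAncientMild C u → ∀ t < 0, ∀ x, u t x = 0) :=
  ⟨rateClassLiouville_of_headInfluxLaw C, fun hL u p hA _ =>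
    ⟨1 / 2, by norm_num, 0, fun a b _ => headInfluxLaw_half_of_rateClassLiouville C hL u p hA a b⟩⟩

/-- **The line closed modulo S4**: the head-influx law at every level `C > 0` implies
`NoTypeIBlowup` (the skeleton's `Target_of`, with its only open stub as the hypothesis): S4 gives
rate-class Liouville level by level (`rateClassLiouville_of_headInfluxLaw`) and the landed zoom +
ladder glue conclude (as in `noTypeIBlowup_of_rateClassLiouville`,
`TypeICertificateLadderTargetRateClassLiouville.lean`). CONDITIONAL on S4 (open). [folklore
composition] -/
theorem noTypeIBlowup_of_headInfluxLaw
    (hS4 : ∀ C : ℝ, 0 < C → ∀ (u : ℝ → EuclideanSpace ℝ (Fin 3) → EuclideanSpace ℝ (Fin 3))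
      (p : ℝ → EuclideanSpace ℝ (Fin 3) → ℝ),
      IsTypeIAncientMild C u → IsClassicalNSSolutionOn (Set.Iio 0) 1 0 u p →
      ∃ ε : ℝ, 0 < ε ∧ ∃ S₀ : ℝ, ∀ a b : ℝ, a + S₀ ≤ b →
        (∫ s in a..b, -(∫ y, (‖lerayOrbit u s y‖ ^ 2 / 2 + lerayOrbitPressure p s y) *
            ⟪y, lerayOrbit u s y⟫ * Real.exp (-‖y‖ ^ 2 / 4)) / 2) ≤
          (1 - ε) * ∫ s in a..b,
            ((∫ y, frobeniusNormSq (fderiv ℝ (lerayOrbit u s) y) * Real.exp (-‖y‖ ^ 2 / 4)) +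
              ∫ y, ‖lerayOrbit u s y‖ ^ 2 / 2 * Real.exp (-‖y‖ ^ 2 / 4))) :
    Summit.NavierStokesRegularity.NavierStokesRegularity.Theses.TypeICertificateLadder.NoTypeIBlowup := by
  unfold Summit.NavierStokesRegularity.NavierStokesRegularity.Theses.TypeICertificateLadder.NoTypeIBlowup
  refine typeICertificateLadder_ladderGlue_proof fun C hC ν T hν hT u p hcl hLH hdec hrate => ?_
  by_contra hext
  obtain ⟨ū, hA, hnon⟩ := stub_typeIZoom C hC ν T hν hT u p hcl hLH hdec hrate hext
  exact hnon (rateClassLiouville_of_headInfluxLaw C (hS4 C hC) ū hA)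

end Summit.NavierStokesRegularity.NavierStokesRegularity.Theorems

end
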